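import Mathlib
import HarnessLib
import Summits.HubbardSuperconductivity.HubbardSuperconductivity.Theorems.KLProgrammeKLRegimeSplitGeoShellLog
import Summits.HubbardSuperconductivity.HubbardSuperconductivity.Theorems.KLProgrammeKLRegimeEngineV8PairTransferRelDefsCB

/-!
# Route `KLProgramme` — ENGINE child gen 8 (stmt-HubbardSuperconductivity-20437 `KLRegimeEngineV17F2`): located risk #15 option (β′), the SYMBOL-LEVEL bridge —
# the relative family with the bar of record yields rev 2's consumer family for the amended package `G.addShellLog C`
# (cell gate-hubbard-kl, seat hubbard-kl-k3c1-p1 g10; sequel of `…SplitGeoShellLog`, p587359)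

`…SplitGeoShellLog` discharged the hosting hypothesis of `pairTransferPinnedAt_of_rel` on NUMERIC weights (`transferBarRelAtWF_le_transferBarAt_addShellLog`).  Here the
weights are the soft mass and the born overlap of an admissible symbol, both `≤ 15367` on an admissible frame with `klBetaMin ≤ β ≤ L` (`klSoftMass_le_of_isSoftSymbol`,
`klShellOverlap_le_klSoftMass`, p585429), so:
**`PairTransferRelFamily.pinnedFamily_addShellLog`** — `PairTransferRelFamily … n (transferBarRelAtF L M G P r β U μ n)` (the class-#5 rev-3 invariant with the bar OF
RECORD) ⟹ `PairTransferPinnedFamily L M (G.addShellLog C) P r′ β U μ n` (rev 2's consumer family, hence step 3 and the (c) closer, for the amended package) whenever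
`15367·r ≤ r′` and `15367·r ≤ r′·C`.  With `klEngGeo9 := klEngGeo8.addShellLog C` this is the by-name entry of class #5 rev 3 into the unchanged downstream.
§2 (append): the same for the family OF RECORD `PairTransferRelFamilyCB` (cutoff-built index, p588716): `PairTransferRelFamilyCB.pinnedAt_addShellLog` / `_compl_addShellLog`.
Bookkeeping only; nothing about the model is asserted.  0 kit.
-/

noncomputable section

namespace Summit.HubbardSuperconductivity.HubbardSuperconductivity.Theorems.KLRegimeSplit

set_option linter.dupNamespace false -- summit = problem name (single-conjunct summit), D-0017

open Real Finset Literature.MathematicalPhysics.QuantumLattice Literature.Probability.LatticeModels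
open Summit.HubbardSuperconductivity.HubbardSuperconductivity.Theorems.KLProgrammeLegKernels
open Summit.HubbardSuperconductivity.HubbardSuperconductivity.Theorems.DispersionFlow

section Bridge

variable {L M : ℕ} [NeZero L] [NeZero M] {R : RenConsts} {N : ℕ}

/-- **The bar of record of the pair `(ψ | 0)` is hosted by rev 2's bar for the amended package** — admissible `ψ` on an admissible flowing frame, `klBetaMin ≤ β ≤ L`,
`15367·r ≤ r′`, `15367·r ≤ r′·C`. -/
theorem transferBarRelAtF_zero_le_transferBarAt_addShellLog {G : GeoConsts} (hCF : 0 ≤ G.CF) (hph : ∀ n ρ, 0 ≤ G.phGain n ρ) {P : SplitConsts}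
    (hK : 0 ≤ P.Klam) {C r r' β U μ : ℝ} (hC : 0 ≤ C) (hr : 0 ≤ r) (hrc : r * 15367 ≤ r') (hrcC : r * 15367 ≤ r' * C) {n : ℕ}
    (hKn : FrameOK R U N μ (klFlowFrameU L M β U μ n)) (hβ : klBetaMin ≤ β) (hβL : β ≤ L) {ψ : FreqMomentum L M → ℝ}
    (hψ : IsSoftSymbol L M β μ (klFlowFrameU L M β U μ n) n ψ) (Qm k k' : TorusSite 2 L) :
    transferBarRelAtF L M G P r β U μ n ψ (fun _ => 0) Qm k k' ≤ transferBarAt L (G.addShellLog C) P r' β U n Qm k k' := by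
  have hβ0 : 0 < β := pos_of_klBetaMin_le hβ
  have hsub : ψ - (fun _ => (0 : ℝ)) = ψ := by funext x; simp
  unfold transferBarRelAtF
  rw [hsub]
  have hms := klSoftMass_le_of_isSoftSymbol hKn hβ hβL hψ
  have hms0 := klSoftMass_nonneg β μ (klFlowFrameU L M β U μ n) hβ0 n ψ
  have hov := (klShellOverlap_le_klSoftMass β μ (klFlowFrameU L M β U μ n) hβ0 n ψ).trans hms
  exact transferBarRelAtWF_le_transferBarAt_addShellLog hCF hph hK hC hr hrc hrcC β U n hms0 hms hov Qm k k'

/-- **CLASS #5 REV 3 ⟹ REV 2's CONSUMER FAMILY, for the amended package**: the relative family with the bar of record at scale `n` gives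
`PairTransferPinnedFamily L M (G.addShellLog C) P r′ β U μ n` (admissible flowing frame, `klBetaMin ≤ β ≤ L`, `15367·r ≤ r′`, `15367·r ≤ r′·C`). -/
theorem PairTransferRelFamily.pinnedFamily_addShellLog {G : GeoConsts} (hCF : 0 ≤ G.CF) (hph : ∀ n ρ, 0 ≤ G.phGain n ρ) {P : SplitConsts}
    (hK : 0 ≤ P.Klam) {C r r' β U μ : ℝ} (hC : 0 ≤ C) (hr : 0 ≤ r) (hrc : r * 15367 ≤ r') (hrcC : r * 15367 ≤ r' * C) {n : ℕ}
    (hKn : FrameOK R U N μ (klFlowFrameU L M β U μ n)) (hβ : klBetaMin ≤ β) (hβL : β ≤ L)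
    (h : PairTransferRelFamily L M β U μ n (transferBarRelAtF L M G P r β U μ n)) :
    PairTransferPinnedFamily L M (G.addShellLog C) P r' β U μ n :=
  h.pinnedFamily fun _ hψ Qm k k' => transferBarRelAtF_zero_le_transferBarAt_addShellLog hCF hph hK hC hr hrc hrcC hKn hβ hβL hψ Qm k k'

end Bridge

/-! ## §2 (APPEND, g10) The cutoff-built twin — the family OF RECORD (`PairTransferRelFamilyCB`, p588716) for the amended package -/

section BridgeCB

variable {L M : ℕ} [NeZero L] [NeZero M] {R : RenConsts} {N : ℕ}

/-- **CLASS #5 REV 3 (CUTOFF-BUILT FAMILY, BAR OF RECORD) ⟹ REV 2's CONSUMER CLAUSE for the amended package**: a cutoff-built member `ψ` of the flowing frame `Kₙ` gets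
`PairTransferPinnedAt L M (G.addShellLog C) P r′ β U μ n ψ` from `PairTransferRelFamilyCB … n (transferBarRelAtF L M G P r β U μ n)` (admissible frame, `klBetaMin ≤ β ≤ L`,
`15367·r ≤ r′`, `15367·r ≤ r′·C`). -/
theorem PairTransferRelFamilyCB.pinnedAt_addShellLog {G : GeoConsts} (hCF : 0 ≤ G.CF) (hph : ∀ n ρ, 0 ≤ G.phGain n ρ) {P : SplitConsts}
    (hK : 0 ≤ P.Klam) {C r r' β U μ : ℝ} (hC : 0 ≤ C) (hr : 0 ≤ r) (hrc : r * 15367 ≤ r') (hrcC : r * 15367 ≤ r' * C) {n : ℕ}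
    (hKn : FrameOK R U N μ (klFlowFrameU L M β U μ n)) (hβ : klBetaMin ≤ β) (hβL : β ≤ L)
    (h : PairTransferRelFamilyCB L M β U μ n (transferBarRelAtF L M G P r β U μ n)) {ψ : FreqMomentum L M → ℝ}
    (hψ : IsCutoffBuilt L M β μ (klFlowFrameU L M β U μ n) n ψ) : PairTransferPinnedAt L M (G.addShellLog C) P r' β U μ n ψ :=
  h.pinnedAt hψ fun Qm k k' => transferBarRelAtF_zero_le_transferBarAt_addShellLog hCF hph hK hC hr hrc hrcC hKn hβ hβL hψ.isSoftSymbol Qm k k'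

/-- The complementary member `softSymbolCompl (Kₙ) n m`, `m ≥ n` (step 3 / the (c) closer read `m := n+1`), for the amended package. -/
theorem PairTransferRelFamilyCB.pinnedAt_compl_addShellLog {G : GeoConsts} (hCF : 0 ≤ G.CF) (hph : ∀ n ρ, 0 ≤ G.phGain n ρ) {P : SplitConsts}
    (hK : 0 ≤ P.Klam) {C r r' β U μ : ℝ} (hC : 0 ≤ C) (hr : 0 ≤ r) (hrc : r * 15367 ≤ r') (hrcC : r * 15367 ≤ r' * C) {n m : ℕ} (hnm : n ≤ m)
    (hKn : FrameOK R U N μ (klFlowFrameU L M β U μ n)) (hβ : klBetaMin ≤ β) (hβL : β ≤ L)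
    (h : PairTransferRelFamilyCB L M β U μ n (transferBarRelAtF L M G P r β U μ n)) :
    PairTransferPinnedAt L M (G.addShellLog C) P r' β U μ n (softSymbolCompl L M β μ (klFlowFrameU L M β U μ n) n m) :=
  h.pinnedAt_addShellLog hCF hph hK hC hr hrc hrcC hKn hβ hβL (isCutoffBuilt_compl β μ _ hnm)

end BridgeCB

end Summit.HubbardSuperconductivity.HubbardSuperconductivity.Theorems.KLRegimeSplit

end
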